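import Summits.QuantumFields.YangMills.Theorems.BalabanUVNodesN09MembershipDomainDoor
import Summits.QuantumFields.YangMills.Theorems.BalabanUVNodesN21RegularityTransferJunction
import Literature.MathematicalPhysics.QuantumFieldTheory.Balaban1983to89.Node00.MembershipDomainOfRecord

/-!
# NODE N09 — DOOR v1.3 AT NODE 00's MEMBERSHIP DOMAIN OF RECORD `domUOfRecord θ.ν θ.εbg ρ`: the bookkeeping of the definition (its definitional [B11]-rows, the collapsed one-radius
# regime, the relation to def-R's first form), its INNER INHABITATION from N07's Theorem-1 slot + ₈a's rows ([B11] Thm 1 (8) — the ONE place it enters, on the inner threshold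
# `ρ∕B₃`, director-ym №309 (ii)), and the door ∕ (1.1)–(1.3) ∕ the world-generic member of `…N09MembershipDomainDoor` INSTANTIATED (`hdom := mem_domUOfRecord_iff`)

TRACK A (YM-PLAN §2d, node N09 of 28), seat `pub-ymgap-dag-n09-w1` (D-0149 width seat 1∕4), generation g8 — director-ym №313 (R2)(R3).  Key of record K1⁹ stmt-QuantumFields-27364
(`--supports … --as helper`, count-neutral).  [I] = [Balaban1987RG1] (CMP 109), [B11] = [Balaban1985Variational] (CMP 102), [B7] = [Balaban1985Averaging] (CMP 98).  Imports the door
`…N09MembershipDomainDoor` (dom-generic), dag-n21-c's `…N21RegularityTransferJunction` (N07's Theorem-1 slot at objects `hT1` + ₈a's rows `hUk` ⇒ `plaqSmall_Uk_of_thm1_objects`) and Node00's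
`MembershipDomainOfRecord` (`domUOfRecord`, `mem_domUOfRecord_iff`).  THEOREMS ONLY (0 `def`, 0 `sorry`).

* §1 BOOKKEEPING of `domUOfRecord` (the Summits-side half of the definition file): `domUOfRecord_subset_domAlt`, `h11_on_domUOfRecord` ∕ `hreg8_on_domUOfRecord` ((1.1) and the (8)-row are
  DEFINITIONAL — no [B11]), `domUOfRecord_mono_ρ`, `mem_domUOfRecord_iff_of_le_ρ` (the COLLAPSED regime `εbg ≤ ρ`: the membership conjunct is `Uk_mem_bgReg`, automatic — the Z3 pin's
  `εreg = εbg = a₀` read as `ρ = εreg`), `domUOfRecord_subset_domOfRecord` (def-R's first form on the solvable-unique set), `domUOfRecord_gaugeAct_iff` (gauge-stable, door §0),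
  `plaqSmall_two_mul_of_mem_domUOfRecord` (⊆ the OUTER second-form set of threshold `2ρ`, [I] p. 260).
* §2 ★★ INNER INHABITATION `mem_domUOfRecord_of_plaqSmall_of_thm1Objects`: a second-form small field `V` with `|V(∂p) − 1| < δ`, `0 < δ ≤ a₁`, `B₃δ ≤ ρ ≤ εbg ≤ a₀`, is a MEMBER — existence and
  `ρ`-membership from N07's slot `hT1` + ₈a's `hUk` at `(K, k, εbg)` through dag-n21-c's `plaqSmall_Uk_of_thm1_objects` ([B11] Thm 1 (8): the minimiser of a `δ`-regular field is `B₃δ`-regular),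
  orbit-uniqueness at `εbg` on the inner set DISPLAYED (`huniqIn` — [B11] Thm 1 (6) at radius `εbg ∈ [B₃δ, a₀]`, print-suppliable; the tree's (2)-class∕plaquette-class divergence D-defB-1 is
  node00∕N07's standing item).  So the door's rows range over a set that [B11] Thm 1 INHABITS from the inner plaquette domain — the non-vacuity half of director-ym №300∕№309 (ii).
* §3 the door AT `domUOfRecord θ₀.ν εbg ρ P.K`: ★★★ `hCompT_onDomU`, ★★★ `indA_onDomU` ((1.1)–(1.3) on the membership domain at the record's own Stage-13 objects, world-free),
  ★★ `thm3Member_onDomU_of_hind` (world-generic; `hind` INHABITED BY: not yet — (D1′) deferred, №313 (R4)).  Displayed rows and their «INHABITED BY» status: as in the door's module docstring.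
* §4 the [B7]-numerics on `ρ` follow from those on `εbg` when `ρ ≤ εbg` (the engine keeps its `hbg3`∕`hbg2` proofs and adds `ρ ≤ a₀`): `numerics_ρ_of_le`.
HONEST FRAMING: count-neutral kernel composition BY NAME; NOTHING of Bałaban's asserted (N07's slot, ₈a's rows, `huniqIn`, `hres`∕`huniq`, (F7a) membership form, openness, axialities are
DISPLAYED); no record core edited ((D0)-labelled in effect, №313 (R4)); N09 ∕ N07 ∕ N24 NOT discharged; K0⁷ ∕ K1⁹ ∕ K3⁸ NOT closed; counts unmoved (typed 28∕28 · discharged 8∕28); one finite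
four-torus programme at fixed ε — R4 closes the conditional rung `BalabanLadder.UV` only; the Yang–Mills mass gap (Clay) is NOT proved by any of this; nothing continuum ∕ ℝ⁴ ∕ OS.
-/

noncomputable section

namespace Summit.QuantumFields.YangMills.BalabanUVNodes.N09MembershipDomainDoorAtRecord

open MeasureTheory
open Literature.MathematicalPhysics.QuantumFieldTheory.Balaban1983to89
open Literature.MathematicalPhysics.QuantumFieldTheory.Balaban1983to89.T4Continuum (T4Family)
open Literature.MathematicalPhysics.QuantumFieldTheory.Balaban1983to89.DagBinding (WorldP leavesP)
open Literature.MathematicalPhysics.QuantumFieldTheory.Balaban1983to89.Node00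
open Literature.MathematicalPhysics.QuantumFieldTheory.Balaban1983to89.FlowStep (HBeta prefixOf RGEqH)
open Literature.MathematicalPhysics.QuantumFieldTheory.Balaban1983to89.FlowStepRuns (genSeq genFlow)
open Literature.MathematicalPhysics.QuantumFieldTheory.Balaban1983to89.ExpMeanLog (deltaSU)
open Literature.MathematicalPhysics.QuantumFieldTheory.Balaban1983to89.B12GaugeOrbits021 (OrbitRel)
open Literature.MathematicalPhysics.QuantumFieldTheory.Balaban1983to89.GaugeField (gaugeAct)
open Summit.QuantumFields.YangMills.BalabanUVNodes.N09BackgroundRadiiTransfer (bgReg_mono)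
open Summit.QuantumFields.YangMills.Theorems.N21RegularityTransferJunction (plaqSmall_Uk_of_thm1_objects)
open Summit.QuantumFields.YangMills.BalabanUVNodes.N09MembershipNestingKernel (plaqSmall_two_mul_of_memChar)
open Summit.QuantumFields.YangMills.BalabanUVNodes.N09MembershipDomainDoor

variable {F : T4Family} {N : ℕ} [NeZero N]

/-! ## §1. Bookkeeping of `domUOfRecord` -/

/-- The characterisation hypothesis `hdom` of the dom-generic door AT Node00's membership domain: `Iff.rfl` per level. [cite: Balaban1987RG1, p.259 and (1.1)–(1.2) p.260 (bookkeeping)] -/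
theorem hdom_domUOfRecord (ν : Stage7Numerics) (εbg ρ : ℝ) (K : ℕ) :
    ∀ k (V : GaugeField (F.P K) k (SU N)), V ∈ domUOfRecord F N ν εbg ρ K k ↔
      V ∈ domAltOfRecord F N ν K k ∧ UkExists F N K k εbg V ∧ UniqueUkOrbit F N K k εbg V ∧ Uk F N K k εbg V ∈ bgReg F N K k ρ :=
  fun k V => mem_domUOfRecord_iff ν εbg ρ K k V

/-- The membership domain lies inside the second-form domain (conjunct 1). [cite: Balaban1987RG1, p.259 (bookkeeping)] -/
theorem domUOfRecord_subset_domAlt (ν : Stage7Numerics) (εbg ρ : ℝ) (K k : ℕ) : domUOfRecord F N ν εbg ρ K k ⊆ domAltOfRecord F N ν K k :=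
  fun _ h => h.1

/-- **(1.1) ON THE MEMBERSHIP DOMAIN IS DEFINITIONAL** (door v1.2's row `h11`, no [B11]). [cite: Balaban1987RG1, (1.1) p.260 (bookkeeping)] -/
theorem h11_on_domUOfRecord (ν : Stage7Numerics) (εbg ρ : ℝ) (K : ℕ) :
    ∀ k, k ≤ K → ∀ V ∈ domUOfRecord F N ν εbg ρ K k, UkExists F N K k εbg V ∧ UniqueUkOrbit F N K k εbg V :=
  h11_of_memChar (hdom_domUOfRecord ν εbg ρ K)

/-- **THE (8)-MEMBERSHIP ROW ON THE MEMBERSHIP DOMAIN IS DEFINITIONAL** for `ρ ≤ ν.εreg` (door v1.2's row `hreg8` = FLAG №7′'s row, no [B11] Thm 1 (8), no `B₃`).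
[cite: Balaban1987RG1, (1.2) p.260; Balaban1985Variational, Thm 1 (8) p.279 (bookkeeping)] -/
theorem hreg8_on_domUOfRecord (ν : Stage7Numerics) (εbg : ℝ) {ρ : ℝ} (hρ : ρ ≤ ν.εreg) (K : ℕ) :
    ∀ k, k ≤ K → ∀ V ∈ domUOfRecord F N ν εbg ρ K k, Uk F N K k εbg V ∈ bgReg F N K k ν.εreg :=
  fun _ _ _ hV => bgReg_mono hρ hV.2.2.2

/-- The membership domain grows with the membership radius. [cite: Balaban1987RG1, p.259 (bookkeeping)] -/
theorem domUOfRecord_mono_ρ (ν : Stage7Numerics) (εbg : ℝ) {ρ ρ' : ℝ} (h : ρ ≤ ρ') (K k : ℕ) :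
    domUOfRecord F N ν εbg ρ K k ⊆ domUOfRecord F N ν εbg ρ' K k :=
  fun _ hV => ⟨hV.1, hV.2.1, hV.2.2.1, bgReg_mono h hV.2.2.2⟩

/-- **THE COLLAPSED (ONE-RADIUS) REGIME**: for `εbg ≤ ρ` (the Z3 pin read as `ρ = εreg = εbg = a₀`) the membership conjunct is AUTOMATIC (`Uk_mem_bgReg`) — the domain is «second-form small
field ∧ (1.1) at `εbg`» and carries no second radius; this is the regime `…N09Reg8RowAtEqualRadiiLocated` §3 shows to be outside [B11]'s window at the first averaged level.
[cite: Balaban1987RG1, (1.1)–(1.2) p.260 (bookkeeping)] -/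
theorem mem_domUOfRecord_iff_of_le_ρ (ν : Stage7Numerics) {εbg ρ : ℝ} (h : εbg ≤ ρ) (K k : ℕ) (V : GaugeField (F.P K) k (SU N)) :
    V ∈ domUOfRecord F N ν εbg ρ K k ↔ V ∈ domAltOfRecord F N ν K k ∧ UkExists F N K k εbg V ∧ UniqueUkOrbit F N K k εbg V :=
  ⟨fun hV => ⟨hV.1, hV.2.1, hV.2.2.1⟩, fun hV => ⟨hV.1, hV.2.1, hV.2.2, bgReg_mono h (Uk_mem_bgReg hV.2.1)⟩⟩

/-- **RELATION TO def-R's FIRST FORM** `domOfRecord ν K k = {V | Uk … k ν.εreg V ∈ bgReg … k ν.ε₀}`: with search radius `ν.εreg` and membership radius `ρ ≤ ν.ε₀`, the membership domain IS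
def-R's first-form domain cut down to the solvable-unique second-form small fields (its documented junk corner removed). [cite: Balaban1987RG1, p.259 (bookkeeping)] -/
theorem domUOfRecord_subset_domOfRecord (ν : Stage7Numerics) {ρ : ℝ} (hρ : ρ ≤ ν.ε₀) (K k : ℕ) :
    domUOfRecord F N ν ν.εreg ρ K k ⊆ domOfRecord F N ν K k := fun V hV => by
  rw [mem_domOfRecord_iff]
  exact (mem_bgReg_iff F N K k ν.ε₀ _).1 (bgReg_mono hρ hV.2.2.2)

/-- The membership domain is GAUGE-STABLE at successor levels (door §0 instantiated). [cite: Balaban1987RG1, (0.21) p.256 and p.259; Balaban1985Variational, (181) p.307] -/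
theorem domUOfRecord_gaugeAct_iff (ν : Stage7Numerics) (εbg ρ : ℝ) {K k : ℕ} (hk : k + 1 ≤ (F.P K).m + (F.P K).K)
    (v : GaugeTransf (F.P K) (k + 1) (SU N)) (W : GaugeField (F.P K) (k + 1) (SU N)) :
    gaugeAct v W ∈ domUOfRecord F N ν εbg ρ K (k + 1) ↔ W ∈ domUOfRecord F N ν εbg ρ K (k + 1) :=
  memChar_gaugeAct_iff (hdom_domUOfRecord ν εbg ρ K) hk v W

/-- The membership domain lies in the OUTER second-form set of threshold `2ρ` ([I] p. 260 «implies |V(∂p′) − 1| < 2ε₀»; [B7] Prop. 2 (53)–(54), tree theorem).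
[cite: Balaban1985Averaging, Prop. 2 (53)–(54) p.26; Balaban1987RG1, (1.2) p.260] -/
theorem plaqSmall_two_mul_of_mem_domUOfRecord (ν : Stage7Numerics) {εbg ρ : ℝ} {K k : ℕ} (hρ : 0 < ρ)
    (hρ3 : (143 * (((((F.P K).d + 4 : ℕ) : ℝ)) ^ 2 / 4) ^ 2) * ρ ≤ 1 / 3)
    (hρ2 : 2 * ρ ≤ 2 * deltaSU (Fin N) / ((((F.P K).d + 4) * (F.P K).L : ℕ) : ℝ) ^ 2) {V : GaugeField (F.P K) k (SU N)}
    (hV : V ∈ domUOfRecord F N ν εbg ρ K k) : PlaqSmall (2 * ρ) V :=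
  plaqSmall_two_mul_of_memChar ν (hdom_domUOfRecord ν εbg ρ K) hρ hρ3 hρ2 hV

/-! ## §2. Inner inhabitation from N07's Theorem-1 slot + ₈a's rows ([B11] Thm 1 (8) on the INNER threshold — the only place it enters) -/

/-- ★★ **THE INNER PLAQUETTE DOMAIN INHABITS THE MEMBERSHIP DOMAIN**: at a member `(K, k)` where N07's Theorem-1 slot at objects `hT1` and ₈a's rows `hUk` hold at radius `εbg` (dag-n21-c's
displayed shapes), every second-form small field `V` with `|V(∂p) − 1| < δ`, `0 < δ ≤ a₁`, `B₃δ ≤ ρ`, `ρ ≤ εbg ≤ a₀`, whose minimal orbit at `εbg` is unique (`huniqIn` — [B11] Thm 1 (6) at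
`εbg ∈ [B₃δ, a₀]`; displayed because the tree's (2)-class ≠ plaquette class, D-defB-1) is a MEMBER: existence from `hUk`, `ρ`-membership from `plaqSmall_Uk_of_thm1_objects` ((8): the
minimiser of record of a `δ`-regular field is `B₃δ`-regular).  CONDITIONAL on the three displayed slots; nothing of Bałaban asserted.
[cite: Balaban1985Variational, Thm 1 (6) and (8) p.279; Balaban1987RG1, (1.1)–(1.2) p.260 and p.259] -/
theorem mem_domUOfRecord_of_plaqSmall_of_thm1Objects (ν : Stage7Numerics) {K k : ℕ} {a₀ a₁ B₃ εbg ρ δ : ℝ}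
    (hT1 : ∀ ε₁ : ℝ, 0 < ε₁ → ε₁ ≤ a₁ → ∀ V : GaugeField (F.P K) k (SU N), PlaqSmall ε₁ V →
      (∃ U : GaugeField (F.P K) 0 (SU N), IsBackground (avOfRecord F N K) {U | InUkClassB11 F N K k (B₃ * ε₁) U} k V U) ∧
      (∀ ε₀ : ℝ, B₃ * ε₁ ≤ ε₀ → ε₀ ≤ a₀ → ∀ U U' : GaugeField (F.P K) 0 (SU N),
          IsBackground (avOfRecord F N K) {U | InUkClassB11 F N K k (B₃ * ε₁) U} k V U →
          IsBackground (avOfRecord F N K) {U | InUkClassB11 F N K k ε₀ U} k V U' → InUkClassB11 F N K k ε₀ U ∧ OrbitRel k U U'))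
    (hUk : ∀ (V : GaugeField (F.P K) k (SU N)) (δ' : ℝ), 0 < δ' → δ' ≤ a₁ → B₃ * δ' ≤ εbg → PlaqSmall δ' V →
      UkExists F N K k εbg V ∧ InUkClassB11 F N K k εbg (Uk F N K k εbg V))
    (huniqIn : ∀ V : GaugeField (F.P K) k (SU N), PlaqSmall δ V → UniqueUkOrbit F N K k εbg V)
    (hδ : 0 < δ) (hδa : δ ≤ a₁) (hδρ : B₃ * δ ≤ ρ) (hρbg : ρ ≤ εbg) (hhi : εbg ≤ a₀)
    {V : GaugeField (F.P K) k (SU N)} (hVdom : V ∈ domAltOfRecord F N ν K k) (hV : PlaqSmall δ V) :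
    V ∈ domUOfRecord F N ν εbg ρ K k := by
  have hδε : B₃ * δ ≤ εbg := hδρ.trans hρbg
  refine ⟨hVdom, (hUk V δ hδ hδa hδε hV).1, huniqIn V hV, ?_⟩
  have h := plaqSmall_Uk_of_thm1_objects hT1 hUk hhi hδ hδa hδε hV
  rw [mem_bgReg_iff]
  exact fun p => (h p).trans_le (mul_le_mul_of_nonneg_right hδρ (sq_nonneg _))

/-! ## §3. The door AT `domUOfRecord θ₀.ν εbg ρ P.K` -/

section Door

variable (θ₀ : Stage13Params F N) (hεχ : 0 < θ₀.ε₂₉) (P : B12.RunParams) {εbg ρ : ℝ}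
  (cd : (j : ℕ) → ContourData (F.P P.K) j (SU N))
  (hopen : ∀ j < P.K, IsOpen (X := PBond (F.P P.K) (j + 1) → SU N) (domUOfRecord F N θ₀.ν εbg ρ P.K (j + 1)))
  (haxDom : ∀ j < P.K, ∀ W ∈ domUOfRecord F N θ₀.ν εbg ρ P.K (j + 1), AxialGauge (cd j) (critCfgOfRecord F N θ₀.ν P.K j W))
  (haxbg : ∀ k, k ≤ P.K → ∀ V ∈ domUOfRecord F N θ₀.ν εbg ρ P.K k, ∀ j < k, AxialGauge (cd j) (Averaging.iter (avOfRecord F N P.K) j (Uk F N P.K k εbg V)))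
  (hχregU : ∀ i, i + 1 < P.K → ∀ U : GaugeField (F.P P.K) (i + 1) (SU N),
    (avOfRecord F N P.K (i + 1)).avg U ∈ domUOfRecord F N θ₀.ν εbg ρ P.K (i + 2) →
      U ∉ regSetOfRecord F N P.K i (betaInputOfRecord F N (TβOfRecord₁₃ F N) (chiβOfRecord₁₃ F N θ₀) P.K (gOfRecord₁₃ F N θ₀ P) i) ∩
          domUOfRecord F N θ₀.ν εbg ρ P.K (i + 1) →
        chiβOfRecord₁₃ F N θ₀ P.K (gOfRecord₁₃ F N θ₀ P) (i + 1) U = 0)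
  (hint : ∀ j < P.K, Integrable (betaInputOfRecord F N (TβOfRecord₁₃ F N) (chiβOfRecord₁₃ F N θ₀) P.K (gOfRecord₁₃ F N θ₀ P) j) (fieldMeasure (F.P P.K) j (SU N)))
  (hres : ∀ k, k ≤ P.K → HRestrict F N εbg P.K k (domUOfRecord F N θ₀.ν εbg ρ P.K k))
  (huniq : ∀ k, k ≤ P.K → ∀ V ∈ domUOfRecord F N θ₀.ν εbg ρ P.K k, ∀ j < k,
    UniqueUkOrbit F N P.K (j + 1) εbg (Averaging.iter (avOfRecord F N P.K) (j + 1) (Uk F N P.K k εbg V)))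
  (hρ : 0 < ρ) (hρreg : ρ ≤ θ₀.ν.εreg) (hle : θ₀.ν.εreg ≤ εbg)
  (hρ3 : (143 * (((((F.P P.K).d + 4 : ℕ) : ℝ)) ^ 2 / 4) ^ 2) * ρ ≤ 1 / 3)
  (hρ2 : 2 * ρ ≤ 2 * deltaSU (Fin N) / ((((F.P P.K).d + 4) * (F.P P.K).L : ℕ) : ℝ) ^ 2) (hρ₀ : 2 * ρ ≤ θ₀.ν.ε₀ * ((F.P P.K).L : ℝ) ^ 2)

include hεχ hopen haxDom haxbg hχregU hint hres huniq hρ hρreg hle hρ3 hρ2 hρ₀ in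
/-- ★★★ **`HCompT` OF THE RECORD's STAGE-13 TRANSPORT∕CUT-OFFS ON THE MEMBERSHIP DOMAIN OF RECORD**, every level `k ≤ P.K` (door §2 at `hdom := mem_domUOfRecord_iff`).  CONDITIONAL on the
displayed rows (`hopen`: INHABITED BY: not yet — [B11] Sect. G (U)-propagation; `hχregU`: INHABITED BY: not yet — K0e's debt in membership form; `hres`∕`huniq`: INHABITED BY: not yet — N07's slot,
inside [B11]'s window iff `2B₃ρ ≤ a₀L²`; `haxDom`∕`haxbg`: conventions, definitional after node00-def's re-points; numerics: the engine's letters). [cite: Balaban1987RG1, (0.21)–(0.23) p.256, (1.1)–(1.3) p.260, (2.1)–(2.3) p.265, (2.9) p.266, (2.16) p.269; Balaban1985Variational, Thm 1 (6), (8)–(10) p.279 and (181) p.307] -/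
theorem hCompT_onDomU :
    ∀ k, k ≤ P.K → HCompT F N (TβOfRecord₁₃ F N) (chiβOfRecord₁₃ F N θ₀) εbg P.K (gOfRecord₁₃ F N θ₀ P) k (domUOfRecord F N θ₀.ν εbg ρ P.K k) :=
  hCompT_onMembershipFamily θ₀ hεχ P (hdom_domUOfRecord θ₀.ν εbg ρ P.K) cd hopen haxDom haxbg hχregU hint hres huniq hρ hρreg hle hρ3 hρ2 hρ₀

include hεχ hopen haxDom haxbg hχregU hint hres huniq hρ hρreg hle hρ3 hρ2 hρ₀ in
/-- ★★★ **(1.1)–(1.3) ON THE MEMBERSHIP DOMAIN OF RECORD AT THE RECORD's OWN STAGE-13 OBJECTS — WORLD-FREE** (door §2 `indA_onMembershipFamily` at `domUOfRecord`): for every level `k ≤ P.K` at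
which the flow recursion of the record's β-functions holds, `IndAOfRecordT (TβOfRecord₁₃) (χ₂₉ of record) εbg (β of record) P k … (domUOfRecord θ₀.ν εbg ρ P.K k) (A_k, A^η(U_k), 𝐄_k of record)`.
CONDITIONAL on the displayed rows; nothing of Bałaban asserted; N09 NOT discharged (the record's leaves read `domAltOfRecord`; this is the (G-a) witness road of №313 (R4)).
[cite: Balaban1987RG1, (1.1)–(1.3) p.260, (0.20)–(0.23) p.256, Thm 3 p.264 and p.265; Balaban1985Variational, Thm 1 (6), (8)–(10) p.279] -/
theorem indA_onDomU :
    ∀ k, k ≤ P.K → RGEqH k (betaOfRecord₁₃ F N θ₀) (genSeq (betaOfRecord₁₃ F N θ₀) P.g0) →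
      IndAOfRecordT F N (TβOfRecord₁₃ F N) (chiβOfRecord₁₃ F N θ₀) εbg (betaOfRecord₁₃ F N θ₀) P k
        (prefixOf (genSeq (betaOfRecord₁₃ F N θ₀) P.g0) k) (domUOfRecord F N θ₀.ν εbg ρ P.K k)
        (effActionOfRecordT F N (TβOfRecord₁₃ F N) (chiβOfRecord₁₃ F N θ₀) (betaOfRecord₁₃ F N θ₀) P k) (wilsonBGOfRecord F N εbg P k)
        (EkOfRecordT F N (TβOfRecord₁₃ F N) (chiβOfRecord₁₃ F N θ₀) εbg (betaOfRecord₁₃ F N θ₀) P k) :=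
  indA_onMembershipFamily θ₀ hεχ P (hdom_domUOfRecord θ₀.ν εbg ρ P.K) cd hopen haxDom haxbg hχregU hint hres huniq hρ hρreg hle hρ3 hρ2 hρ₀

include hεχ hopen haxDom haxbg hχregU hint hres huniq hρ hρreg hle hρ3 hρ2 hρ₀ in
/-- ★★ **N09's THEOREM-3 MEMBER FOR A WORLD WHOSE RUN-`P` CONSTRUCTION HAS `IndAss k` = (1.1)–(1.3) ON `domUOfRecord θ₀.ν εbg ρ P.K k`** (`hflow`, `hind` DISPLAYED; INHABITED BY: not yet — no
landed core has `dom := domUOfRecord`, (D1′) deferred by №313 (R4)).  CONDITIONAL; N09 NOT discharged; K1⁹ NOT closed. [cite: Balaban1987RG1, Thm 3 p.264, (1.1)–(1.3) p.260 and (2.16) p.269; Balaban1985Variational, Thm 1 (8)–(10) p.279] -/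
theorem thm3Member_onDomU_of_hind {w : WorldP} (hflow : (w.C P).flow = genFlow (betaOfRecord₁₃ F N θ₀) P.g0)
    (hind : ∀ k, k ≤ P.K → ((w.C P).IndAss k ↔
      IndAOfRecordT F N (TβOfRecord₁₃ F N) (chiβOfRecord₁₃ F N θ₀) εbg (betaOfRecord₁₃ F N θ₀) P k
        (prefixOf (genSeq (betaOfRecord₁₃ F N θ₀) P.g0) k) (domUOfRecord F N θ₀.ν εbg ρ P.K k)
        (effActionOfRecordT F N (TβOfRecord₁₃ F N) (chiβOfRecord₁₃ F N θ₀) (betaOfRecord₁₃ F N θ₀) P k) (wilsonBGOfRecord F N εbg P k)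
        (EkOfRecordT F N (TβOfRecord₁₃ F N) (chiβOfRecord₁₃ F N θ₀) εbg (betaOfRecord₁₃ F N θ₀) P k))) :
    (leavesP w P).smallCouplings → (leavesP w P).smallFieldInductive :=
  thm3Member_onMembershipFamily_of_hind θ₀ hεχ P (hdom_domUOfRecord θ₀.ν εbg ρ P.K) cd hopen haxDom haxbg hχregU hint hres huniq hρ hρreg hle hρ3 hρ2 hρ₀ hflow hind

end Door

/-! ## §4. The [B7]-numerics on the membership radius follow from those on the search radius -/

omit [NeZero N] in
/-- For `ρ ≤ εbg`, the two [B7]-numerics rows the door displays on `ρ` follow from the engine's rows on `εbg` (so the Z3 engine keeps its `hbg3`∕`hbg2` proofs and adds only `ρ ≤ a₀`).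
[cite: Balaban1985Averaging, Prop. 2 (53) p.26 (bookkeeping)] -/
theorem numerics_ρ_of_le {K : ℕ} {εbg ρ : ℝ} (hρle : ρ ≤ εbg)
    (hε3 : (143 * (((((F.P K).d + 4 : ℕ) : ℝ)) ^ 2 / 4) ^ 2) * εbg ≤ 1 / 3)
    (hε2 : 2 * εbg ≤ 2 * deltaSU (Fin N) / ((((F.P K).d + 4) * (F.P K).L : ℕ) : ℝ) ^ 2) :
    (143 * (((((F.P K).d + 4 : ℕ) : ℝ)) ^ 2 / 4) ^ 2) * ρ ≤ 1 / 3 ∧ 2 * ρ ≤ 2 * deltaSU (Fin N) / ((((F.P K).d + 4) * (F.P K).L : ℕ) : ℝ) ^ 2 := by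
  have hc : 0 ≤ (143 * (((((F.P K).d + 4 : ℕ) : ℝ)) ^ 2 / 4) ^ 2) := by positivity
  exact ⟨(mul_le_mul_of_nonneg_left hρle hc).trans hε3, (by linarith : 2 * ρ ≤ 2 * εbg).trans hε2⟩

end Summit.QuantumFields.YangMills.BalabanUVNodes.N09MembershipDomainDoorAtRecord

end
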